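import Mathlib.Data.Fintype.BigOperators
import Mathlib.Data.Fintype.Pi
import Mathlib.Data.Fin.Tuple.Basic
import Mathlib.Algebra.BigOperators.Ring.Finset
import Mathlib.Algebra.Order.BigOperators.Group.Finset
import Literature.Computability.AlgebraicComplexity.RandomRestrictionCounting
import Literature.Computability.AlgebraicComplexity.TransferRecursion
import HarnessLib

/-!
# Walks in one block of the random restriction: entries, agreements, and counting
(Kumar–Saraf 2017, §8.3 and §9.1)

Topic `Literature/Computability/AlgebraicComplexity`; infrastructure for the printed proof of
`kumarSaraf2017_imm_homDepthFour` (`HomogeneousDepthFour.lean`), Step 5 of the roadmap: the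
combinatorics of ONE block of `k` regular layers of `IMM^*` under Kumar–Saraf's distribution
(every row of layer `j` keeps `deg j` random entries; sample space `rowSpace`,
`RandomRestrictionCounting.lean`).

* `Walk k n = Fin (k+1) → Fin n` — vertex walks; `Alive ω p` — every step of `p` uses an entry
  kept by `ω`; `entries p` — the `k` entries (layer, row, column) read by `p`; `agree p q` — the
  layers on which `p` and `q` read the same entry (`Δ(p,q) = k - |agree p q|` for the corresponding
  monomials, [KS, Def. 3.4]).
* `cols p q ρ` — the columns of the entries of `p ∪ q` in the row `ρ = (layer, row)`;
  `alive_and_alive_iff` (both alive iff every row keeps these columns),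
  `sum_card_cols` (`= |entries p ∪ entries q|`), `card_entries_union`
  (`= 2k - |agree p q|`), `prod_pow_card_cols_mul` (`∏_ρ deg^{|cols ρ|} · ∏_{j ∈ agree} deg_j =
  (∏_j deg_j)²`).
* **`card_bothAlive_mul_le`** — the second-moment count:
  `#{ω : p, q alive} · ñ^{2k - |agree|} · ∏_{j ∈ agree} deg_j ≤ |Ω| · (∏_j deg_j)²`
  ("the events across different rows are independent", [KS, Lemma 8.2 / §9.1]).
* `card_walks_prescribed_le` — walks with prescribed vertices on a set `S` of positions number at
  most `ñ^{k+1-|S|}`; `positions A` — the positions constrained by agreement on the layers `A`;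
  **`card_insert_zero_positions`**: `|{0} ∪ positions A| = |A| + runCost true A + 1`
  (`KumarSaraf.runCost`, `TransferRecursion.lean`: a maximal run of agreements not starting at
  layer `0` constrains one extra vertex — Kumar–Saraf's "agree switch"), and
  `card_positions_of_zero_notMem` (`= |A| + runCost false A` when `0 ∉ A`).

Everything is proved; no named facts.

## References

* M. Kumar, S. Saraf, *On the power of homogeneous depth 4 arithmetic circuits*, SIAM J. Comput.
  46 (2017) 336–387 (arXiv:1404.1950): §8.3 (walks in the layered graph), Lemma 8.2, §9.1
  (Lemmas 9.2–9.4: agreements and switches).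
-/

namespace Literature.Computability.AlgebraicComplexity.KumarSaraf

open Finset

variable {k n : ℕ}

/-! ### Walks, entries, agreements -/

/-- A vertex walk through a block of `k` layers on `n` vertices per layer. [cite: KumarSaraf2017, §8.3] -/
abbrev Walk (k n : ℕ) : Type := Fin (k + 1) → Fin n

/-- The entry (layer, row, column) read by the walk `p` at layer `j`. [cite: KumarSaraf2017, §8.3] -/
def entryAt (p : Walk k n) (j : Fin k) : Fin k × Fin n × Fin n := (j, p j.castSucc, p j.succ)

/-- The walk is alive under `ω` (row `(j, u)` keeps the columns `ω (j, u)`): every entry it reads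
is kept. [cite: KumarSaraf2017, §8.3] -/
def Alive (ω : Fin k × Fin n → Finset (Fin n)) (p : Walk k n) : Prop :=
  ∀ j : Fin k, p j.succ ∈ ω (j, p j.castSucc)

/-- Aliveness is decidable. [folklore] -/
instance Alive.decidable (ω : Fin k × Fin n → Finset (Fin n)) (p : Walk k n) : Decidable (Alive ω p) := by
  unfold Alive; infer_instance

/-- The entries read by a walk. [cite: KumarSaraf2017, §8.3] -/
def entries (p : Walk k n) : Finset (Fin k × Fin n × Fin n) := univ.image (entryAt p)

/-- The layers on which two walks read the same entry. [cite: KumarSaraf2017, Def. 3.4] -/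
def agree (p q : Walk k n) : Finset (Fin k) := univ.filter fun j => entryAt p j = entryAt q j

/-- `entryAt p` is injective (the layer is recorded). [folklore] -/
theorem entryAt_injective (p : Walk k n) : Function.Injective (entryAt p) :=
  fun _ _ h => (Prod.ext_iff.1 h).1

/-- A walk reads `k` entries. [cite: KumarSaraf2017, §8.3] -/
theorem card_entries (p : Walk k n) : (entries p).card = k := by
  rw [entries, card_image_of_injective _ (entryAt_injective p), card_univ, Fintype.card_fin]

/-- Membership in `entries`. [folklore] -/
theorem mem_entries {p : Walk k n} {e : Fin k × Fin n × Fin n} :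
    e ∈ entries p ↔ entryAt p e.1 = e := by
  rw [entries, mem_image]
  constructor
  · rintro ⟨j, -, rfl⟩; rfl
  · intro h; exact ⟨e.1, mem_univ _, h⟩

/-- The common entries of two walks are those of the agreement layers. [cite: KumarSaraf2017, Def. 3.4] -/
theorem entries_inter (p q : Walk k n) : entries p ∩ entries q = (agree p q).image (entryAt p) := by
  ext e
  rw [mem_inter, mem_entries, mem_entries, mem_image]
  constructor
  · rintro ⟨hp, hq⟩
    refine ⟨e.1, mem_filter.2 ⟨mem_univ _, hp.trans hq.symm⟩, hp⟩
  · rintro ⟨j, hj, rfl⟩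
    have h := (mem_filter.1 hj).2
    exact ⟨rfl, by rw [h]; rfl⟩

/-- **`|entries p ∪ entries q| = 2k - |agree p q|`** (the union has `k + Δ` variables).
[cite: KumarSaraf2017, Def. 3.4] -/
theorem card_entries_union (p q : Walk k n) :
    (entries p ∪ entries q).card + (agree p q).card = 2 * k := by
  have h := card_union_add_card_inter (entries p) (entries q)
  rw [card_entries, card_entries, entries_inter,
    card_image_of_injective _ (entryAt_injective p)] at h
  omega

/-! ### Rows and the second-moment count -/

/-- The columns of the entries of `p ∪ q` lying in the row `ρ = (layer, row)`.
[cite: KumarSaraf2017, Lemma 8.2] -/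
def cols (p q : Walk k n) (ρ : Fin k × Fin n) : Finset (Fin n) :=
  ((entries p ∪ entries q).filter fun e => (e.1, e.2.1) = ρ).image fun e => e.2.2

/-- **Both walks are alive iff every row keeps the columns of their entries in it.**
[cite: KumarSaraf2017, Lemma 8.2] -/
theorem alive_and_alive_iff (ω : Fin k × Fin n → Finset (Fin n)) (p q : Walk k n) :
    (Alive ω p ∧ Alive ω q) ↔ ∀ ρ, cols p q ρ ⊆ ω ρ := by
  constructor
  · rintro ⟨hp, hq⟩ ρ c hc
    rw [cols, mem_image] at hc
    obtain ⟨e, he, rfl⟩ := hc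
    rw [mem_filter, mem_union] at he
    obtain ⟨he, rfl⟩ := he
    rcases he with he | he
    · rw [mem_entries] at he; rw [← he]; exact hp e.1
    · rw [mem_entries] at he; rw [← he]; exact hq e.1
  · intro h
    have key : ∀ r : Walk k n, entries r ⊆ entries p ∪ entries q → Alive ω r := by
      intro r hr j
      have he : entryAt r j ∈ entries p ∪ entries q := hr (mem_entries.2 rfl)
      have : r j.succ ∈ cols p q (j, r j.castSucc) := by
        rw [cols, mem_image]
        exact ⟨entryAt r j, mem_filter.2 ⟨he, rfl⟩, rfl⟩
      exact h _ this
    exact ⟨key p subset_union_left, key q subset_union_right⟩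

/-- **`∑_ρ |cols ρ| = |entries p ∪ entries q|`** (each entry lies in exactly one row).
[folklore] -/
theorem sum_card_cols (p q : Walk k n) :
    ∑ ρ, (cols p q ρ).card = (entries p ∪ entries q).card := by
  have hinj : ∀ ρ, Set.InjOn (fun e : Fin k × Fin n × Fin n => e.2.2)
      ↑((entries p ∪ entries q).filter fun e => (e.1, e.2.1) = ρ) := by
    intro ρ e₁ h₁ e₂ h₂ h
    rw [mem_coe, mem_filter] at h₁ h₂
    have h1 := h₁.2.trans h₂.2.symm
    exact Prod.ext (Prod.ext_iff.1 h1).1 (Prod.ext (Prod.ext_iff.1 h1).2 h)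
  simp_rw [cols, fun ρ => card_image_of_injOn (hinj ρ)]
  rw [← card_eq_sum_card_fiberwise (f := fun e : Fin k × Fin n × Fin n => (e.1, e.2.1))]
  exact fun _ _ => mem_univ _

/-- **`∏_ρ deg^{|cols ρ|} · ∏_{j ∈ agree} deg_j = (∏_j deg_j)²`** (regroup the row product by
entries; the common entries are counted once in the union). [folklore] -/
theorem prod_pow_card_cols_mul (deg : Fin k → ℕ) (p q : Walk k n) :
    (∏ ρ, deg ρ.1 ^ (cols p q ρ).card) * ∏ j ∈ agree p q, deg j = (∏ j, deg j) ^ 2 := by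
  -- regroup by entries
  have hregroup : ∏ ρ, deg ρ.1 ^ (cols p q ρ).card = ∏ e ∈ entries p ∪ entries q, deg e.1 := by
    have hinj : ∀ ρ, Set.InjOn (fun e : Fin k × Fin n × Fin n => e.2.2)
        ↑((entries p ∪ entries q).filter fun e => (e.1, e.2.1) = ρ) := by
      intro ρ e₁ h₁ e₂ h₂ h
      rw [mem_coe, mem_filter] at h₁ h₂
      have h1 := h₁.2.trans h₂.2.symm
      exact Prod.ext (Prod.ext_iff.1 h1).1 (Prod.ext (Prod.ext_iff.1 h1).2 h)
    rw [← prod_fiberwise_of_maps_to (g := fun e : Fin k × Fin n × Fin n => (e.1, e.2.1))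
      (t := univ) (fun _ _ => mem_univ _)]
    refine prod_congr rfl fun ρ _ => ?_
    rw [cols, card_image_of_injOn (hinj ρ), card_eq_sum_ones, ← prod_pow_eq_pow_sum]
    refine prod_congr rfl fun e he => ?_
    rw [pow_one, ← (mem_filter.1 he).2]
  rw [hregroup]
  have h2 : ∏ j ∈ agree p q, deg j = ∏ e ∈ entries p ∩ entries q, deg e.1 := by
    rw [entries_inter, prod_image fun _ _ _ _ h => entryAt_injective p h]
    rfl
  rw [h2, prod_union_inter, sq]
  congr 1 <;> rw [entries, prod_image fun _ _ _ _ h => entryAt_injective _ h] <;> rfl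

/-- **The second-moment count** (Kumar–Saraf 2017, Lemma 8.2 / §9.1: rows are independent, a row
keeps `a` fixed entries with probability `≤ (deg/ñ)^a`): for two walks `p, q` in a block with
degrees `deg`,
`#{ω : p and q alive} · ñ^{2k - |agree p q|} · ∏_{j ∈ agree p q} deg_j ≤ |Ω| · (∏_j deg_j)²`,
i.e. `Pr[p, q alive] ≤ P_p P_q ∏_{common entries} (ñ/deg)`, `P_p = ∏_j deg_j/ñ`.
[cite: KumarSaraf2017, Lemma 8.2 and Prop. 9.1] -/
theorem card_bothAlive_mul_le (deg : Fin k → ℕ) (p q : Walk k n) :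
    ((rowSpace (fun ρ : Fin k × Fin n => deg ρ.1)).filter (fun ω => Alive ω p ∧ Alive ω q)).card *
        n ^ (2 * k - (agree p q).card) * ∏ j ∈ agree p q, deg j ≤
      (rowSpace (α := Fin n) (fun ρ : Fin k × Fin n => deg ρ.1)).card * (∏ j, deg j) ^ 2 := by
  have h := card_rowSpace_filter_superset_mul_le (α := Fin n) (fun ρ : Fin k × Fin n => deg ρ.1)
    (cols p q)
  rw [Fintype.card_fin, prod_pow_eq_pow_sum, sum_card_cols] at h
  have hfilter : ((rowSpace (fun ρ : Fin k × Fin n => deg ρ.1)).filter fun ω => Alive ω p ∧ Alive ω q)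
      = (rowSpace (fun ρ : Fin k × Fin n => deg ρ.1)).filter fun ω => ∀ ρ, cols p q ρ ⊆ ω ρ := by
    refine filter_congr fun ω _ => alive_and_alive_iff ω p q
  have hexp : 2 * k - (agree p q).card = (entries p ∪ entries q).card := by
    have := card_entries_union p q; omega
  rw [hfilter, hexp]
  calc _ = ((rowSpace (fun ρ : Fin k × Fin n => deg ρ.1)).filter (fun ω => ∀ ρ, cols p q ρ ⊆ ω ρ)).card *
        n ^ (entries p ∪ entries q).card * ∏ j ∈ agree p q, deg j := rfl
    _ ≤ (rowSpace (α := Fin n) (fun ρ : Fin k × Fin n => deg ρ.1)).card *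
        (∏ ρ, deg ρ.1 ^ (cols p q ρ).card) * ∏ j ∈ agree p q, deg j := Nat.mul_le_mul_right _ h
    _ = _ := by rw [mul_assoc, prod_pow_card_cols_mul]

/-! ### Counting walks with prescribed vertices -/

/-- **Walks with prescribed vertices**: the walks agreeing with a fixed walk on a set `S` of
positions number at most `ñ^{k+1-|S|}`. [folklore] -/
theorem card_walks_prescribed_le (t : Walk k n) (S : Finset (Fin (k + 1))) :
    ((univ : Finset (Walk k n)).filter fun q => ∀ i ∈ S, q i = t i).card ≤ n ^ (k + 1 - S.card) := by
  classical
  -- inject into the functions on the complement of `S`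
  have hcard : Fintype.card ({i : Fin (k + 1) // i ∉ S} → Fin n) = n ^ (k + 1 - S.card) := by
    rw [Fintype.card_fun, Fintype.card_fin, Fintype.card_subtype_compl, Fintype.card_fin]
    congr 1
    rw [Fintype.card_subtype]
    congr 1
    simp
  rw [← hcard, ← card_univ]
  refine card_le_card_of_injOn (fun q => fun i : {i : Fin (k + 1) // i ∉ S} => q i.1)
    (fun _ _ => mem_coe.2 (mem_univ _)) ?_
  intro q₁ h₁ q₂ h₂ h
  rw [mem_coe, mem_filter] at h₁ h₂
  funext i
  by_cases hi : i ∈ S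
  · rw [h₁.2 i hi, h₂.2 i hi]
  · exact congrFun h ⟨i, hi⟩

/-- The positions constrained by agreement on the layers `A`: both endpoints of every layer of `A`.
[cite: KumarSaraf2017, Lemma 9.4] -/
def positions (A : Finset (Fin k)) : Finset (Fin (k + 1)) := A.image Fin.castSucc ∪ A.image Fin.succ

/-- If `q` agrees with `p` on the layers `A`, it has the vertices of `p` at the constrained
positions. [cite: KumarSaraf2017, Lemma 9.4] -/
theorem eq_on_positions {p q : Walk k n} {A : Finset (Fin k)} (h : A ⊆ agree p q) :
    ∀ i ∈ positions A, q i = p i := by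
  intro i hi
  rw [positions, mem_union, mem_image, mem_image] at hi
  rcases hi with ⟨j, hj, rfl⟩ | ⟨j, hj, rfl⟩
  · have := (mem_filter.1 (h hj)).2
    exact ((Prod.ext_iff.1 (Prod.ext_iff.1 this).2).1).symm
  · have := (mem_filter.1 (h hj)).2
    exact ((Prod.ext_iff.1 (Prod.ext_iff.1 this).2).2).symm

/-- The layers as natural numbers. [folklore] -/
def natLayers (A : Finset (Fin k)) : Finset ℕ := A.map Fin.valEmbedding

/-- `natLayers A ⊆ [k]`. [folklore] -/
theorem natLayers_subset (A : Finset (Fin k)) : natLayers A ⊆ range k := by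
  intro x hx
  rw [natLayers, mem_map] at hx
  obtain ⟨j, -, rfl⟩ := hx
  exact mem_range.2 j.2

/-- Membership in `natLayers`. [folklore] -/
theorem mem_natLayers {A : Finset (Fin k)} {x : ℕ} :
    x ∈ natLayers A ↔ ∃ h : x < k, (⟨x, h⟩ : Fin k) ∈ A := by
  rw [natLayers, mem_map]
  constructor
  · rintro ⟨j, hj, rfl⟩; exact ⟨j.2, hj⟩
  · rintro ⟨h, hx⟩; exact ⟨⟨x, h⟩, hx, rfl⟩

/-- `|natLayers A| = |A|`. [folklore] -/
theorem card_natLayers (A : Finset (Fin k)) : (natLayers A).card = A.card := by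
  rw [natLayers, card_map]

/-- **The constrained positions in terms of charged runs**: `|positions A| = |A| + #{starts}` where
a start of `A` is `j ∈ A` with `j - 1 ∉ A` (`j = 0` always a start), and
`|{0} ∪ positions A| = |A| + runCost true A + 1`, `runCost true` charging exactly the starts
`≠ 0` — a maximal run of agreements needs one extra common vertex, free when the run begins at the
common start vertex. [cite: KumarSaraf2017, Lemma 9.4] -/
theorem card_insert_zero_positions (A : Finset (Fin k)) :
    (insert 0 (positions A)).card = A.card + runCost true (natLayers A) + 1 := by
  classical
  -- `positions A = image succ A ⊔ starts`, `starts = {castSucc j : j ∈ A, j = 0 ∨ j-1 ∉ A}`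
  set starts : Finset (Fin k) := A.filter fun j => (j : ℕ) = 0 ∨ ∀ h : (j : ℕ) - 1 < k,
    (⟨(j : ℕ) - 1, h⟩ : Fin k) ∉ A with hstarts
  have hdecomp : positions A = A.image Fin.succ ∪ starts.image Fin.castSucc := by
    ext i
    rw [positions, mem_union, mem_union, mem_image, mem_image, mem_image]
    constructor
    · rintro (⟨j, hj, rfl⟩ | h)
      · -- `castSucc j`: either a start, or `j - 1 ∈ A` and then `castSucc j = succ (j-1)`
        by_cases hs : j ∈ starts
        · exact Or.inr ⟨j, hs, rfl⟩
        · left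
          rw [hstarts, mem_filter, not_and_or] at hs
          rcases hs with hs | hs
          · exact absurd hj hs
          · push Not at hs
            obtain ⟨hj0, h, hmem⟩ := hs
            refine ⟨⟨(j : ℕ) - 1, h⟩, hmem, Fin.ext ?_⟩
            simp only [Fin.val_succ, Fin.val_castSucc]
            omega
      · exact Or.inl h
    · rintro (h | ⟨j, hj, rfl⟩)
      · exact Or.inr h
      · exact Or.inl ⟨j, (mem_filter.1 hj).1, rfl⟩
  have hdisj : Disjoint (A.image Fin.succ) (starts.image Fin.castSucc) := by
    rw [disjoint_left]
    intro i hi hi'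
    rw [mem_image] at hi hi'
    obtain ⟨j, hj, rfl⟩ := hi
    obtain ⟨j', hj', heq⟩ := hi'
    have hval : (j' : ℕ) = (j : ℕ) + 1 := by
      have := congrArg Fin.val heq
      simp only [Fin.val_castSucc, Fin.val_succ] at this
      exact this
    rw [hstarts, mem_filter] at hj'
    rcases hj'.2 with h0 | h
    · omega
    · have hlt : (j' : ℕ) - 1 < k := by omega
      have := h hlt
      have hjj : (⟨(j' : ℕ) - 1, hlt⟩ : Fin k) = j := Fin.ext (by simp only; omega)
      rw [hjj] at this
      exact this hj
  have h0 : (0 : Fin (k + 1)) ∉ A.image Fin.succ := by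
    rw [mem_image]; rintro ⟨j, -, hj⟩; exact Fin.succ_ne_zero j hj
  -- `0 ∈ starts.image castSucc ↔ 0 ∈ A`
  have hcount : (insert 0 (positions A)).card = A.card + starts.card + if (∃ h : 0 < k, (⟨0, h⟩ : Fin k) ∈ A) then 0 else 1 := by
    rw [hdecomp]
    by_cases hz : ∃ h : 0 < k, (⟨0, h⟩ : Fin k) ∈ A
    · obtain ⟨hk, hzA⟩ := hz
      have hzs : (⟨0, hk⟩ : Fin k) ∈ starts := mem_filter.2 ⟨hzA, Or.inl rfl⟩
      have h0mem : (0 : Fin (k + 1)) ∈ A.image Fin.succ ∪ starts.image Fin.castSucc :=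
        mem_union_right _ (mem_image.2 ⟨_, hzs, rfl⟩)
      rw [insert_eq_of_mem h0mem, card_union_of_disjoint hdisj, card_image_of_injective _
        (Fin.succ_injective k), card_image_of_injective _ (Fin.castSucc_injective k),
        if_pos ⟨hk, hzA⟩, add_zero]
    · have h0nmem : (0 : Fin (k + 1)) ∉ A.image Fin.succ ∪ starts.image Fin.castSucc := by
        rw [mem_union, not_or]
        refine ⟨h0, fun h => hz ?_⟩
        rw [mem_image] at h
        obtain ⟨j, hj, hj0⟩ := h
        have hjv : (j : ℕ) = 0 := by
          have := congrArg Fin.val hj0; simpa using this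
        refine ⟨by omega, ?_⟩
        have : (⟨0, by omega⟩ : Fin k) = j := Fin.ext (by simp [hjv])
        rw [this]; exact (mem_filter.1 hj).1
      rw [card_insert_of_notMem h0nmem, card_union_of_disjoint hdisj, card_image_of_injective _
        (Fin.succ_injective k), card_image_of_injective _ (Fin.castSucc_injective k), if_neg hz]
  rw [hcount]
  -- `runCost true (natLayers A) = #starts - [0 ∈ A]`
  have hrun : runCost true (natLayers A) + (if (∃ h : 0 < k, (⟨0, h⟩ : Fin k) ∈ A) then 1 else 0)
      = starts.card := by
    unfold runCost
    -- charged elements: `x ∈ natLayers A`, `x ≠ 0`, `x - 1 ∉ natLayers A`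
    have hcharged : ((natLayers A).filter fun j => ¬ (if j = 0 then true = true else j - 1 ∈ natLayers A))
        = (starts.filter fun j : Fin k => j.val ≠ 0).map Fin.valEmbedding := by
      ext x
      rw [mem_filter, mem_natLayers, mem_map]
      constructor
      · rintro ⟨⟨hx, hxA⟩, hcond⟩
        have hx0 : x ≠ 0 := by rintro rfl; simp at hcond
        rw [if_neg hx0, mem_natLayers] at hcond
        push Not at hcond
        refine ⟨⟨x, hx⟩, mem_filter.2 ⟨mem_filter.2 ⟨hxA, Or.inr fun h => hcond h⟩, hx0⟩, rfl⟩
      · rintro ⟨j, hj, rfl⟩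
        rw [mem_filter] at hj
        obtain ⟨hjs, hj0⟩ := hj
        rw [hstarts, mem_filter] at hjs
        refine ⟨⟨j.2, hjs.1⟩, ?_⟩
        rw [Fin.valEmbedding_apply, if_neg hj0, mem_natLayers]
        push Not
        intro h
        rcases hjs.2 with h0 | hh
        · exact absurd h0 hj0
        · exact hh h
    rw [hcharged, card_map]
    by_cases hz : ∃ h : 0 < k, (⟨0, h⟩ : Fin k) ∈ A
    · obtain ⟨hk, hzA⟩ := hz
      rw [if_pos ⟨hk, hzA⟩]
      have hzs : (⟨0, hk⟩ : Fin k) ∈ starts := mem_filter.2 ⟨hzA, Or.inl rfl⟩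
      have : (starts.filter fun j : Fin k => j.val ≠ 0) = starts.erase ⟨0, hk⟩ := by
        ext j
        simp only [mem_filter, mem_erase, ne_eq, Fin.ext_iff]
        tauto
      rw [this, card_erase_add_one hzs]
    · rw [if_neg hz, add_zero]
      congr 1
      refine filter_true_of_mem fun j hj => ?_
      intro hj0
      exact hz ⟨by omega, by
        have : (⟨0, by omega⟩ : Fin k) = j := Fin.ext (by simp [hj0])
        rw [this]; exact (mem_filter.1 hj).1⟩
  split_ifs at hrun ⊢ with hz <;> omega

/-- **Different starts**: if `0 ∉ A` then `0 ∉ positions A` and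
`|positions A| = |A| + runCost false A` (every run is charged). [cite: KumarSaraf2017, Lemma 9.4] -/
theorem card_positions_of_zero_notMem (A : Finset (Fin k))
    (h0 : ∀ h : 0 < k, (⟨0, h⟩ : Fin k) ∉ A) :
    (positions A).card = A.card + runCost false (natLayers A) ∧ (0 : Fin (k + 1)) ∉ positions A := by
  classical
  have hnot : (0 : Fin (k + 1)) ∉ positions A := by
    rw [positions, mem_union, mem_image, mem_image, not_or]
    constructor
    · rintro ⟨j, hj, hj0⟩
      have : (j : ℕ) = 0 := by have := congrArg Fin.val hj0; simpa using this
      exact h0 (by omega) (by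
        have e : (⟨0, by omega⟩ : Fin k) = j := Fin.ext (by simp [this])
        rw [e]; exact hj)
    · rintro ⟨j, -, hj⟩; exact Fin.succ_ne_zero j hj
  refine ⟨?_, hnot⟩
  have h1 := card_insert_zero_positions A
  rw [card_insert_of_notMem hnot] at h1
  -- `runCost false = runCost true` when `0 ∉ natLayers A`
  have h2 : runCost false (natLayers A) = runCost true (natLayers A) := by
    unfold runCost
    congr 1
    refine filter_congr fun x hx => ?_
    have hx0 : x ≠ 0 := by
      rintro rfl
      rw [mem_natLayers] at hx
      obtain ⟨h, hx⟩ := hx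
      exact h0 h hx
    rw [if_neg hx0, if_neg hx0]
  omega

end Literature.Computability.AlgebraicComplexity.KumarSaraf
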